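import Mathlib
import Summits.ValiantsHypothesis.ValiantsHypothesis.Theorems.NewtonUnitEquationsDissociatedUniformGreedyGale

/-!
# Lex-greedy sets along a pencil of heights, II: the block step

When the height order changes by reversing the blocks of a level function `ℓ` (inside each level the order flips from
descending slope `v` to ascending slope), the lex-greedy set changes level by level into the greedy set of the QUOTIENT
configuration (modulo the span of the higher levels) for the reversed order; Gale dominance in the quotient and the
combinatorial lemma give: the `U`-rank sum of the greedy set does not decrease, and stays equal only if the greedy set is
unchanged (`BlockStep.sum_rk_le`).  Part of Theorem Q of line `greedy-basis-shadow` (crux stmt-ValiantsHypothesis-5905).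
[folklore]
-/

set_option linter.dupNamespace false

namespace Summit.ValiantsHypothesis.ValiantsHypothesis.Theorems.NewtonUnitEquationsDissociatedUniform

open scoped BigOperators

namespace BlockStep

variable {α : Type} {K V : Type*} [DivisionRing K] [AddCommGroup V] [Module K V]

/-- Membership modulo a submodule: `y ∉ W ⊔ span S ↔ mkQ y ∉ span (mkQ '' S)`. [folklore] -/
theorem not_mem_sup_span_iff (W : Submodule K V) (S : Set V) (y : V) :
    y ∉ W ⊔ Submodule.span K S ↔ W.mkQ y ∉ Submodule.span K (W.mkQ '' S) := by
  rw [not_iff_not, ← Submodule.map_span, ← Submodule.mem_comap, Submodule.comap_map_eq, Submodule.ker_mkQ,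
    sup_comm]

section Setting

variable (E : Finset α) (x : α → V) (gm gp ℓ v : α → ℝ)
  (hgm : Set.InjOn gm E) (hgp : Set.InjOn gp E)
  (hm : ∀ e ∈ E, ∀ e' ∈ E, gm e < gm e' ↔ (ℓ e < ℓ e' ∨ (ℓ e = ℓ e' ∧ v e' < v e)))
  (hp : ∀ e ∈ E, ∀ e' ∈ E, gp e < gp e' ↔ (ℓ e < ℓ e' ∨ (ℓ e = ℓ e' ∧ v e < v e')))

include hm in
/-- `v` is injective on each level (from the `gm`-characterisation and injectivity of `gm`). -/
theorem injOn_v_level (hgm : Set.InjOn gm E) (e₀ : α) :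
    Set.InjOn v (E.filter fun e => ℓ e = ℓ e₀ : Finset α) := by
  intro a ha b hb hab
  rw [Finset.coe_filter] at ha hb
  obtain ⟨haE, hal⟩ := ha
  obtain ⟨hbE, hbl⟩ := hb
  have h1 : ¬ gm a < gm b := by
    rw [hm a haE b hbE]; rintro (h | ⟨_, h⟩)
    · rw [hal, hbl] at h; exact lt_irrefl _ h
    · rw [hab] at h; exact lt_irrefl _ h
  have h2 : ¬ gm b < gm a := by
    rw [hm b hbE a haE]; rintro (h | ⟨_, h⟩)
    · rw [hal, hbl] at h; exact lt_irrefl _ h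
    · rw [hab] at h; exact lt_irrefl _ h
  exact hgm haE hbE (le_antisymm (not_lt.mp h2) (not_lt.mp h1))

/-- The level of `e₀` as a finset. -/
noncomputable def levelSet (e₀ : α) : Finset α := E.filter fun e => ℓ e = ℓ e₀
/-- The span of everything strictly above the level of `e₀`. -/
noncomputable def aboveSpan (e₀ : α) : Submodule K V := Submodule.span K (x '' {e' : α | e' ∈ E ∧ ℓ e₀ < ℓ e'})

include hm in
/-- Inside a level, `Gm` is the ascending-`v` greedy set of the quotient configuration. [folklore] -/
theorem mem_gset_gm_iff (e₀ e : α) (he : e ∈ levelSet E ℓ e₀) :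
    e ∈ GreedyGale.gset (K := K) E x gm ↔
      e ∈ GreedyGale.gset (K := K) (levelSet E ℓ e₀) ((aboveSpan (K := K) E x ℓ e₀).mkQ ∘ x) (fun a => -v a) := by
  obtain ⟨heE, hel⟩ := Finset.mem_filter.mp he
  rw [GreedyGale.mem_gset, GreedyGale.mem_gset]
  have hsplit : {e' : α | e' ∈ E ∧ gm e < gm e'} =
      {e' : α | e' ∈ E ∧ ℓ e₀ < ℓ e'} ∪ {e' : α | e' ∈ levelSet E ℓ e₀ ∧ -v e < -v e'} := by
    ext e'
    simp only [Set.mem_setOf_eq, Set.mem_union, levelSet, Finset.mem_filter, neg_lt_neg_iff]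
    constructor
    · rintro ⟨he'E, hlt⟩
      rcases (hm e heE e' he'E).mp hlt with h | ⟨h1, h2⟩
      · left; exact ⟨he'E, hel ▸ h⟩
      · right; exact ⟨⟨he'E, by rw [← h1, hel]⟩, h2⟩
    · rintro (⟨he'E, hlt⟩ | ⟨⟨he'E, hl'⟩, hlt⟩)
      · exact ⟨he'E, (hm e heE e' he'E).mpr (Or.inl (hel ▸ hlt))⟩
      · exact ⟨he'E, (hm e heE e' he'E).mpr (Or.inr ⟨by rw [hel, hl'], hlt⟩)⟩
  rw [hsplit, Set.image_union, Submodule.span_union]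
  change (e ∈ E ∧ x e ∉ aboveSpan (K := K) E x ℓ e₀ ⊔ _) ↔ _
  rw [not_mem_sup_span_iff, ← Set.image_comp]
  exact ⟨fun h => ⟨he, h.2⟩, fun h => ⟨heE, h.2⟩⟩

include hp in
/-- Inside a level, `Gp` is the descending-`v` greedy set of the quotient configuration. [folklore] -/
theorem mem_gset_gp_iff (e₀ e : α) (he : e ∈ levelSet E ℓ e₀) :
    e ∈ GreedyGale.gset (K := K) E x gp ↔
      e ∈ GreedyGale.gset (K := K) (levelSet E ℓ e₀) ((aboveSpan (K := K) E x ℓ e₀).mkQ ∘ x) v := by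
  obtain ⟨heE, hel⟩ := Finset.mem_filter.mp he
  rw [GreedyGale.mem_gset, GreedyGale.mem_gset]
  have hsplit : {e' : α | e' ∈ E ∧ gp e < gp e'} =
      {e' : α | e' ∈ E ∧ ℓ e₀ < ℓ e'} ∪ {e' : α | e' ∈ levelSet E ℓ e₀ ∧ v e < v e'} := by
    ext e'
    simp only [Set.mem_setOf_eq, Set.mem_union, levelSet, Finset.mem_filter]
    constructor
    · rintro ⟨he'E, hlt⟩
      rcases (hp e heE e' he'E).mp hlt with h | ⟨h1, h2⟩
      · left; exact ⟨he'E, hel ▸ h⟩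
      · right; exact ⟨⟨he'E, by rw [← h1, hel]⟩, h2⟩
    · rintro (⟨he'E, hlt⟩ | ⟨⟨he'E, hl'⟩, hlt⟩)
      · exact ⟨he'E, (hp e heE e' he'E).mpr (Or.inl (hel ▸ hlt))⟩
      · exact ⟨he'E, (hp e heE e' he'E).mpr (Or.inr ⟨by rw [hel, hl'], hlt⟩)⟩
  rw [hsplit, Set.image_union, Submodule.span_union]
  change (e ∈ E ∧ x e ∉ aboveSpan (K := K) E x ℓ e₀ ⊔ _) ↔ _
  rw [not_mem_sup_span_iff, ← Set.image_comp]
  exact ⟨fun h => ⟨he, h.2⟩, fun h => ⟨heE, h.2⟩⟩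

/-! ### Dominance and the potential comparison per level -/

variable [Module.Finite K V]

open scoped Classical

include hm hp in
/-- Gale dominance inside a level: above every slope threshold `Gm` has at most as many elements as `Gp`. [folklore] -/
theorem card_level_gm_le (hgm : Set.InjOn gm E) (e₀ : α) (τ : ℝ) :
    ((levelSet E ℓ e₀).filter fun e => e ∈ GreedyGale.gset (K := K) E x gm ∧ τ < v e).card ≤
      ((levelSet E ℓ e₀).filter fun e => e ∈ GreedyGale.gset (K := K) E x gp ∧ τ < v e).card := by
  classical
  set L := levelSet E ℓ e₀ with hL
  set xq : α → V ⧸ aboveSpan (K := K) E x ℓ e₀ := (aboveSpan (K := K) E x ℓ e₀).mkQ ∘ x with hxq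
  have hvL : Set.InjOn v (L : Set α) := injOn_v_level E gm ℓ v hm hgm e₀
  -- `I = L ∩ Gm` is independent in the quotient (ascending greedy), `G = L ∩ Gp` is the descending greedy set
  set I : Finset α := L.filter fun e => e ∈ GreedyGale.gset (K := K) E x gm with hI
  set G : Finset α := L.filter fun e => e ∈ GreedyGale.gset (K := K) E x gp with hG
  have hIgset : ∀ e ∈ I, e ∈ GreedyGale.gset (K := K) L xq (fun a => -v a) := by
    intro e he
    obtain ⟨heL, hem⟩ := Finset.mem_filter.mp he
    exact (mem_gset_gm_iff (K := K) E x gm ℓ v hm e₀ e heL).mp hem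
  have hIli : LinearIndependent K (fun e : I => xq e) :=
    GreedyGale.linearIndependent_gset (K := K) L xq (fun a => -v a)
      (fun a ha b hb hab => hvL ha hb (neg_injective hab)) I hIgset
  have hGiff : ∀ e, e ∈ G ↔ e ∈ GreedyGale.gset (K := K) L xq v := by
    intro e
    rw [hG, Finset.mem_filter]
    constructor
    · rintro ⟨heL, hep⟩; exact (mem_gset_gp_iff (K := K) E x gp ℓ v hp e₀ e heL).mp hep
    · intro h; exact ⟨h.1, (mem_gset_gp_iff (K := K) E x gp ℓ v hp e₀ e h.1).mpr h⟩
  have hdom := GreedyGale.card_filter_le_of_linearIndependent (K := K) L xq v I (Finset.filter_subset _ _) hIli τ G hGiff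
  have e1 : (L.filter fun e => e ∈ GreedyGale.gset (K := K) E x gm ∧ τ < v e) = I.filter fun e => τ < v e := by
    rw [hI, Finset.filter_filter]
  have e2 : (L.filter fun e => e ∈ GreedyGale.gset (K := K) E x gp ∧ τ < v e) = G.filter fun e => τ < v e := by
    rw [hG, Finset.filter_filter]
  rw [e1, e2]
  exact hdom

include hm hp in
/-- The reverse dominance (below every threshold `Gp` has at most as many elements as `Gm`), from the same lemma with the
slope negated. [folklore] -/
theorem card_level_gp_le (hgp : Set.InjOn gp E) (e₀ : α) (τ : ℝ) :
    ((levelSet E ℓ e₀).filter fun e => e ∈ GreedyGale.gset (K := K) E x gp ∧ v e < τ).card ≤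
      ((levelSet E ℓ e₀).filter fun e => e ∈ GreedyGale.gset (K := K) E x gm ∧ v e < τ).card := by
  classical
  set L := levelSet E ℓ e₀ with hL
  set xq : α → V ⧸ aboveSpan (K := K) E x ℓ e₀ := (aboveSpan (K := K) E x ℓ e₀).mkQ ∘ x with hxq
  have hvL : Set.InjOn v (L : Set α) := by
    -- symmetric to `injOn_v_level`, through `gp`
    intro a ha b hb hab
    rw [hL, levelSet, Finset.coe_filter] at ha hb
    obtain ⟨haE, hal⟩ := ha
    obtain ⟨hbE, hbl⟩ := hb
    have h1 : ¬ gp a < gp b := by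
      rw [hp a haE b hbE]; rintro (h | ⟨_, h⟩)
      · rw [hal, hbl] at h; exact lt_irrefl _ h
      · rw [hab] at h; exact lt_irrefl _ h
    have h2 : ¬ gp b < gp a := by
      rw [hp b hbE a haE]; rintro (h | ⟨_, h⟩)
      · rw [hal, hbl] at h; exact lt_irrefl _ h
      · rw [hab] at h; exact lt_irrefl _ h
    exact hgp haE hbE (le_antisymm (not_lt.mp h2) (not_lt.mp h1))
  set I : Finset α := L.filter fun e => e ∈ GreedyGale.gset (K := K) E x gp with hI
  set G : Finset α := L.filter fun e => e ∈ GreedyGale.gset (K := K) E x gm with hG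
  have hIgset : ∀ e ∈ I, e ∈ GreedyGale.gset (K := K) L xq v := by
    intro e he
    obtain ⟨heL, hep⟩ := Finset.mem_filter.mp he
    exact (mem_gset_gp_iff (K := K) E x gp ℓ v hp e₀ e heL).mp hep
  have hIli : LinearIndependent K (fun e : I => xq e) :=
    GreedyGale.linearIndependent_gset (K := K) L xq v hvL I hIgset
  have hGiff : ∀ e, e ∈ G ↔ e ∈ GreedyGale.gset (K := K) L xq (fun a => -v a) := by
    intro e
    rw [hG, Finset.mem_filter]
    constructor
    · rintro ⟨heL, hem⟩; exact (mem_gset_gm_iff (K := K) E x gm ℓ v hm e₀ e heL).mp hem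
    · intro h; exact ⟨h.1, (mem_gset_gm_iff (K := K) E x gm ℓ v hm e₀ e h.1).mpr h⟩
  have hdom := GreedyGale.card_filter_le_of_linearIndependent (K := K) L xq (fun a => -v a) I
    (Finset.filter_subset _ _) hIli (-τ) G hGiff
  have e1 : (L.filter fun e => e ∈ GreedyGale.gset (K := K) E x gp ∧ v e < τ) = I.filter fun e => -τ < -v e := by
    rw [hI, Finset.filter_filter]; simp only [neg_lt_neg_iff]
  have e2 : (L.filter fun e => e ∈ GreedyGale.gset (K := K) E x gm ∧ v e < τ) = G.filter fun e => -τ < -v e := by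
    rw [hG, Finset.filter_filter]; simp only [neg_lt_neg_iff]
  rw [e1, e2]
  exact hdom

include hm hp in
/-- The two greedy sets have equally many elements in each level. [folklore] -/
theorem card_level_eq (hgm : Set.InjOn gm E) (hgp : Set.InjOn gp E) (e₀ : α) :
    ((levelSet E ℓ e₀).filter fun e => e ∈ GreedyGale.gset (K := K) E x gm).card =
      ((levelSet E ℓ e₀).filter fun e => e ∈ GreedyGale.gset (K := K) E x gp).card := by
  classical
  set L := levelSet E ℓ e₀
  -- thresholds beyond all values of `v` on `L`
  obtain ⟨τlo, hlo⟩ : ∃ τ : ℝ, ∀ e ∈ L, τ < v e := by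
    rcases L.eq_empty_or_nonempty with h | h
    · exact ⟨0, by simp [h]⟩
    · obtain ⟨e, he, hmin⟩ := Finset.exists_min_image L v h
      exact ⟨v e - 1, fun e' he' => by linarith [hmin e' he']⟩
  obtain ⟨τhi, hhi⟩ : ∃ τ : ℝ, ∀ e ∈ L, v e < τ := by
    rcases L.eq_empty_or_nonempty with h | h
    · exact ⟨0, by simp [h]⟩
    · obtain ⟨e, he, hmax⟩ := Finset.exists_max_image L v h
      exact ⟨v e + 1, fun e' he' => by linarith [hmax e' he']⟩
  have h1 := card_level_gm_le (K := K) E x gm gp ℓ v hm hp hgm e₀ τlo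
  have h2 := card_level_gp_le (K := K) E x gm gp ℓ v hm hp hgp e₀ τhi
  have r1 : ∀ P : α → Prop, ∀ [DecidablePred P], (L.filter fun e => P e ∧ τlo < v e) = L.filter fun e => P e := by
    intro P _; ext e; simp only [Finset.mem_filter]
    exact ⟨fun h => ⟨h.1, h.2.1⟩, fun h => ⟨h.1, h.2, hlo e h.1⟩⟩
  have r2 : ∀ P : α → Prop, ∀ [DecidablePred P], (L.filter fun e => P e ∧ v e < τhi) = L.filter fun e => P e := by
    intro P _; ext e; simp only [Finset.mem_filter]
    exact ⟨fun h => ⟨h.1, h.2.1⟩, fun h => ⟨h.1, h.2, hhi e h.1⟩⟩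
  rw [r1, r1] at h1
  rw [r2, r2] at h2
  exact le_antisymm h1 h2

/-- The `U`-rank of the slope: `r e = #{e' ∈ U : v e' < v e}`. -/
noncomputable def rk (U : Finset α) (v : α → ℝ) (e : α) : ℕ := (U.filter fun e' => v e' < v e).card

omit [DivisionRing K] [AddCommGroup V] [Module K V] [Module.Finite K V] in
/-- The `U`-rank is strictly monotone in the slope on `U`. -/
theorem rk_lt_rk (U : Finset α) (v : α → ℝ) {a b : α} (ha : a ∈ U) (hab : v a < v b) : rk U v a < rk U v b := by
  classical
  unfold rk
  apply Finset.card_lt_card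
  refine ⟨fun e he => ?_, fun hsub => ?_⟩
  · rw [Finset.mem_filter] at he ⊢; exact ⟨he.1, he.2.trans hab⟩
  · have : a ∈ U.filter fun e' => v e' < v a := hsub (Finset.mem_filter.mpr ⟨ha, hab⟩)
    exact lt_irrefl _ (Finset.mem_filter.mp this).2

include hm hp in
/-- **Per-level potential comparison.**  If both greedy sets lie in `U`, then on each level the `U`-rank sum of `Gm` is
at most that of `Gp`, with equality only if they coincide on the level. [folklore] -/
theorem level_sum_le (hgm : Set.InjOn gm E) (hgp : Set.InjOn gp E) (U : Finset α)
    (hUm : ∀ e ∈ E, e ∈ GreedyGale.gset (K := K) E x gm → e ∈ U)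
    (hUp : ∀ e ∈ E, e ∈ GreedyGale.gset (K := K) E x gp → e ∈ U) (e₀ : α) :
    (∑ e ∈ (levelSet E ℓ e₀).filter (fun e => e ∈ GreedyGale.gset (K := K) E x gm), rk U v e ≤
      ∑ e ∈ (levelSet E ℓ e₀).filter (fun e => e ∈ GreedyGale.gset (K := K) E x gp), rk U v e) ∧
    ((∑ e ∈ (levelSet E ℓ e₀).filter (fun e => e ∈ GreedyGale.gset (K := K) E x gm), rk U v e =
      ∑ e ∈ (levelSet E ℓ e₀).filter (fun e => e ∈ GreedyGale.gset (K := K) E x gp), rk U v e) →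
      (levelSet E ℓ e₀).filter (fun e => e ∈ GreedyGale.gset (K := K) E x gm) =
        (levelSet E ℓ e₀).filter (fun e => e ∈ GreedyGale.gset (K := K) E x gp)) := by
  classical
  set L := levelSet E ℓ e₀ with hL
  set LU := L.filter fun e => e ∈ U with hLU
  have hvLU : Set.InjOn v (LU : Set α) := fun a ha b hb hab =>
    injOn_v_level E gm ℓ v hm hgm e₀ (Finset.mem_of_mem_filter a ha) (Finset.mem_of_mem_filter b hb) hab
  have hrk : ∀ a ∈ LU, ∀ b ∈ LU, v a < v b → rk U v a < rk U v b :=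
    fun a ha b _ hab => rk_lt_rk U v (Finset.mem_filter.mp ha).2 hab
  set S := L.filter fun e => e ∈ GreedyGale.gset (K := K) E x gm with hS
  set T := L.filter fun e => e ∈ GreedyGale.gset (K := K) E x gp with hT
  have hSLU : S ⊆ LU := by
    intro e he
    obtain ⟨heL, hem⟩ := Finset.mem_filter.mp he
    exact Finset.mem_filter.mpr ⟨heL, hUm e (Finset.mem_of_mem_filter e heL) hem⟩
  have hTLU : T ⊆ LU := by
    intro e he
    obtain ⟨heL, hep⟩ := Finset.mem_filter.mp he
    exact Finset.mem_filter.mpr ⟨heL, hUp e (Finset.mem_of_mem_filter e heL) hep⟩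
  have hcard : S.card = T.card := card_level_eq (K := K) E x gm gp ℓ v hm hp hgm hgp e₀
  have hdom : ∀ τ : ℝ, (S.filter fun e => τ < v e).card ≤ (T.filter fun e => τ < v e).card := by
    intro τ
    have h := card_level_gm_le (K := K) E x gm gp ℓ v hm hp hgm e₀ τ
    have eS : (L.filter fun e => e ∈ GreedyGale.gset (K := K) E x gm ∧ τ < v e) = S.filter fun e => τ < v e := by
      rw [hS, Finset.filter_filter]
    have eT : (L.filter fun e => e ∈ GreedyGale.gset (K := K) E x gp ∧ τ < v e) = T.filter fun e => τ < v e := by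
      rw [hT, Finset.filter_filter]
    rwa [eS, eT] at h
  exact ComboLemma.sum_le_sum_of_dominance LU v hvLU (rk U v) hrk T.card S T hSLU hTLU hcard rfl hdom

include hm hp in
/-- **Block step (global).**  If both greedy sets lie in `U`, the `U`-rank sum of `Gm` is at most that of `Gp`, with
equality only if `Gm = Gp` (as subsets of `E`). [folklore] -/
theorem sum_rk_le (hgm : Set.InjOn gm E) (hgp : Set.InjOn gp E) (U : Finset α)
    (hUm : ∀ e ∈ E, e ∈ GreedyGale.gset (K := K) E x gm → e ∈ U)
    (hUp : ∀ e ∈ E, e ∈ GreedyGale.gset (K := K) E x gp → e ∈ U) :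
    (∑ e ∈ E.filter (fun e => e ∈ GreedyGale.gset (K := K) E x gm), rk U v e ≤
      ∑ e ∈ E.filter (fun e => e ∈ GreedyGale.gset (K := K) E x gp), rk U v e) ∧
    ((∑ e ∈ E.filter (fun e => e ∈ GreedyGale.gset (K := K) E x gm), rk U v e =
      ∑ e ∈ E.filter (fun e => e ∈ GreedyGale.gset (K := K) E x gp), rk U v e) →
      E.filter (fun e => e ∈ GreedyGale.gset (K := K) E x gm) =
        E.filter (fun e => e ∈ GreedyGale.gset (K := K) E x gp)) := by
  set Sm := E.filter (fun e => e ∈ GreedyGale.gset (K := K) E x gm) with hSm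
  set Sp := E.filter (fun e => e ∈ GreedyGale.gset (K := K) E x gp) with hSp
  -- decompose both sums along the levels `ℓ`
  have hmaps_m : ∀ e ∈ Sm, ℓ e ∈ E.image ℓ := fun e he => Finset.mem_image_of_mem ℓ (Finset.mem_of_mem_filter e he)
  have hmaps_p : ∀ e ∈ Sp, ℓ e ∈ E.image ℓ := fun e he => Finset.mem_image_of_mem ℓ (Finset.mem_of_mem_filter e he)
  have dm := (Finset.sum_fiberwise_of_maps_to hmaps_m (rk U v)).symm
  have dp := (Finset.sum_fiberwise_of_maps_to hmaps_p (rk U v)).symm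
  -- the fibre over `c = ℓ e₀` is the level filter used in `level_sum_le`
  have fib : ∀ (P : α → Prop) (e₀ : α), ((E.filter fun e => P e).filter fun e => ℓ e = ℓ e₀) =
      (levelSet E ℓ e₀).filter fun e => P e := by
    intro P e₀; ext e; simp only [Finset.mem_filter, levelSet]; tauto
  have key : ∀ c ∈ E.image ℓ,
      (∑ e ∈ Sm.filter (fun e => ℓ e = c), rk U v e ≤ ∑ e ∈ Sp.filter (fun e => ℓ e = c), rk U v e) ∧
      ((∑ e ∈ Sm.filter (fun e => ℓ e = c), rk U v e = ∑ e ∈ Sp.filter (fun e => ℓ e = c), rk U v e) →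
        Sm.filter (fun e => ℓ e = c) = Sp.filter (fun e => ℓ e = c)) := by
    intro c hc
    obtain ⟨e₀, _, rfl⟩ := Finset.mem_image.mp hc
    rw [hSm, hSp, fib, fib]
    exact level_sum_le (K := K) E x gm gp ℓ v hm hp hgm hgp U hUm hUp e₀
  refine ⟨?_, fun heq => ?_⟩
  · rw [dm, dp]
    exact Finset.sum_le_sum fun c hc => (key c hc).1
  · have hterm : ∀ c ∈ E.image ℓ,
        ∑ e ∈ Sm.filter (fun e => ℓ e = c), rk U v e = ∑ e ∈ Sp.filter (fun e => ℓ e = c), rk U v e := by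
      rw [dm, dp] at heq
      exact (Finset.sum_eq_sum_iff_of_le fun c hc => (key c hc).1).mp heq
    ext e
    constructor
    · intro he
      have hc : ℓ e ∈ E.image ℓ := hmaps_m e he
      have : e ∈ Sm.filter (fun e' => ℓ e' = ℓ e) := Finset.mem_filter.mpr ⟨he, rfl⟩
      rw [(key _ hc).2 (hterm _ hc)] at this
      exact Finset.mem_of_mem_filter e this
    · intro he
      have hc : ℓ e ∈ E.image ℓ := hmaps_p e he
      have : e ∈ Sp.filter (fun e' => ℓ e' = ℓ e) := Finset.mem_filter.mpr ⟨he, rfl⟩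
      rw [← (key _ hc).2 (hterm _ hc)] at this
      exact Finset.mem_of_mem_filter e this

end Setting

end BlockStep

/-- **The block step, definition-free export** (`V = ℂ^k`; greedy sets given as finsets `Gm`, `Gp`): reversing the blocks of
a level function inside the height order does not decrease the `U`-rank sum of the lex-greedy set, and keeps it equal only
if the greedy set is unchanged. [folklore] -/
theorem lexGreedy_block_step (α : Type) (k : ℕ) (E U Gm Gp : Finset α) (x : α → Fin k → ℂ) (gm gp ℓ v : α → ℝ)
    (hm : ∀ e ∈ E, ∀ e' ∈ E, gm e < gm e' ↔ (ℓ e < ℓ e' ∨ (ℓ e = ℓ e' ∧ v e' < v e)))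
    (hp : ∀ e ∈ E, ∀ e' ∈ E, gp e < gp e' ↔ (ℓ e < ℓ e' ∨ (ℓ e = ℓ e' ∧ v e < v e')))
    (hgm : Set.InjOn gm E) (hgp : Set.InjOn gp E)
    (hGm : ∀ e, e ∈ Gm ↔ e ∈ E ∧ x e ∉ Submodule.span ℂ (x '' {e' : α | e' ∈ E ∧ gm e < gm e'}))
    (hGp : ∀ e, e ∈ Gp ↔ e ∈ E ∧ x e ∉ Submodule.span ℂ (x '' {e' : α | e' ∈ E ∧ gp e < gp e'}))
    (hUm : Gm ⊆ U) (hUp : Gp ⊆ U) :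
    (∑ e ∈ Gm, Set.ncard {e' : α | e' ∈ U ∧ v e' < v e} ≤ ∑ e ∈ Gp, Set.ncard {e' : α | e' ∈ U ∧ v e' < v e}) ∧
    (∑ e ∈ Gm, Set.ncard {e' : α | e' ∈ U ∧ v e' < v e} = ∑ e ∈ Gp, Set.ncard {e' : α | e' ∈ U ∧ v e' < v e} →
      Gm = Gp) := by
  classical
  have h := BlockStep.sum_rk_le (K := ℂ) E x gm gp ℓ v hm hp hgm hgp U
    (fun e _ he => hUm ((hGm e).mpr he)) (fun e _ he => hUp ((hGp e).mpr he))
  have hfm : E.filter (fun e => e ∈ GreedyGale.gset (K := ℂ) E x gm) = Gm := by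
    ext e; simp only [Finset.mem_filter, GreedyGale.mem_gset, hGm]; tauto
  have hfp : E.filter (fun e => e ∈ GreedyGale.gset (K := ℂ) E x gp) = Gp := by
    ext e; simp only [Finset.mem_filter, GreedyGale.mem_gset, hGp]; tauto
  have hrk : ∀ e, BlockStep.rk U v e = Set.ncard {e' : α | e' ∈ U ∧ v e' < v e} := by
    intro e
    unfold BlockStep.rk
    rw [← Set.ncard_coe_finset]
    congr 1
    ext e'; simp
  simp only [hfm, hfp, hrk] at h
  exact h

end Summit.ValiantsHypothesis.ValiantsHypothesis.Theorems.NewtonUnitEquationsDissociatedUniform
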